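import Summits.BirchSwinnertonDyer.BirchSwinnertonDyer.Theorems.KatoDescentPotSupersingularWildFineSelmerOrdinaryAnchor
import Summits.BirchSwinnertonDyer.Rank1Residual.Additive.SharpenedStatements
import Literature.NumberTheory.EllipticCurves.FineSelmerCongruentCurves
import HarnessLib

/-!
# Route `KatoDescentTamePotSupersingular` (rung K8-t′, cell `bsd-potss`): the CONGRUENCE ROAD with
# ordinary-type anchors for the (t′) Conj-A crux `TameFineSelmerCoatesSujatha` (item stmt-BirchSwinnertonDyer-19413)
# — the (t′) twin of the K9 files of seat k9-c4 g3 (idle-prover courtesy to seat k8t-c4); ROUTE-FREE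
# (a `--supports … --as helper` file; nothing booked, BSD is not proved by any of this)

Everything of the K9 road is `p`-general: Lim–Sujatha 2018 Prop. 3.2 (tree fact
`LimSujatha2018.prop32_fineSelmerDual_moduleFinite_iff_of_torsionIso`, `p ≠ 2`), the fine-Selmer Kato
fact (p420034, any odd additive potentially good `p`), the kernel theorem
`WildFineSelmerOrdinaryAnchor.conjA_of_finite_selmerInfty_pTorsion` (`Sel_{p^∞}(W′/K_∞)[p]` finite ⟹
(A), any number field). This file states the two consequences for the TAME class (t′) (`Addv ∧ SubTprime`,
`e ∈ {3,4,6}`, `ord_p j ≥ 0` from `¬ PotMult`): the row form of the road and the crux BODY from per-row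
mixed certificates (one congruent curve with (A), or with finite `p`-torsion in its classical Selmer
group over every cyclotomic `ℤ_p`-tower — Greenberg–Vatsal's `μ = 0` with cotorsion, certified per
curve by Greenberg's Thm. 4.1 / Kato 17.4 / GV Thm. 1.4; no condition on the image of `W′[p]`). At
`p ≥ 5` the ♯ rows of 19413 (90 / 292, k8t-c4 census) are Cartan-normaliser rows exactly as at `3`; a
good-ordinary anchor needs `ρ̄|G_{ℚ_p}` reducible (`p` split in the Cartan field). Conditional on the
displayed named facts; item 19413 is NOT closed.

References: [LimSujatha2018] §3 Prop. 3.2; [GreenbergVatsal2000] Prop. (2.8), Thm. (1.4);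
[Kato2004Asterisque] Thm. 14.5 (3) (p. 236), Prop. 14.16 (2) (p. 244); [Miller2011LMS] Def. 1.1.
-/

set_option autoImplicit false
-- sibling precedent (`KatoDescentPotSupersingularAssembly.lean`): the directory name repeats the summit name
set_option linter.dupNamespace false

noncomputable section

open scoped Classical

namespace Summit.BirchSwinnertonDyer.BirchSwinnertonDyer.Theorems.TameFineSelmerOrdinaryAnchor

open WeierstrassCurve Literature.NumberTheory.EllipticCurves
  Literature.NumberTheory.EllipticCurves.Rank1Residual
  Literature.NumberTheory.EllipticCurves.Rank1Residual.Typed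
  Summit.BirchSwinnertonDyer.Rank1Residual Summit.BirchSwinnertonDyer.Rank1Residual.Additive
  Summit.BirchSwinnertonDyer.Rank1Residual.O6
  Summit.BirchSwinnertonDyer.BirchSwinnertonDyer.Theorems

/-- **The congruence road at an odd additive potentially good prime, row form.** Granted Lim–Sujatha
(`hLS`, tree fact), the fine-Selmer Kato fact (`hKatoA`), GZK (`hGZK`) and modularity (`hmod`): on a
rank-`0` row, `p ≠ 2` additive with `ord_p j ≥ 0` and `W[p]` irreducible, ONE elliptic `W′/ℚ` with
`W′[p] ≃ W[p]` and finite `Sel_{p^∞}(W′/ℚ^cyc)[p]` for every cyclotomic datum gives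
`MissingUpperBoundAt W p`. (No (t′) hypothesis is used beyond `ord_p j ≥ 0`; stated for every odd
additive potentially good row.) [cite: LimSujatha2018, §3 Prop. 3.2] [cite: GreenbergVatsal2000, §2 Prop. (2.8)]
[cite: Kato2004Asterisque, Thm. 14.5 (3) (p. 236), Prop. 14.16 (2) (p. 244)] [cite: Miller2011LMS, Def. 1.1] -/
theorem missingUpperBoundAt_addv_of_congruent_of_finite_selmerInfty_pTorsion
    (hLS : LimSujatha2018.prop32_fineSelmerDual_moduleFinite_iff_of_torsionIso)
    (hKatoA :
      Kato2004.rankZero_padicValNat_sha_add_padicValNat_tamagawa_le_of_additive_potGood_of_irreducible_of_fineSelmerDual_fg)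
    (hGZK : rank_eq_analyticRank_of_analyticRank_le_one) (hmod : hasEntireLFunction_rat)
    (W : WeierstrassCurve ℚ) [W.IsElliptic] [W.IsGloballyMinimal] (p : ℕ) [Fact p.Prime]
    (hr : W.analyticRank = 0) (hp : p ≠ 2) (hA : Addv W p) (hj : 0 ≤ padicValRat p W.j)
    (hirr : W.HasIrreducibleModPGaloisRep p)
    (hanchor : ∃ (W' : WeierstrassCurve ℚ) (_ : W'.IsElliptic), ModPCongruent W' W p ∧
      ∀ (κ : ZpExtension ℚ p), κ.IsCyclotomic → Set.Finite {s : W'.selmerInfty κ | p • s = 0}) :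
    MissingUpperBoundAt W p := by
  obtain ⟨W', hW', hcong, hfin'⟩ := hanchor
  haveI := hW'
  -- (A) at `(W′, p)` from the finiteness of `Sel(W′/ℚ^cyc)[p]`, then (A) at `(W, p)` by Lim–Sujatha
  have hAW : ∀ (κ : ZpExtension ℚ p), κ.IsCyclotomic →
      ∃ (γ : Field.absoluteGaloisGroup ℚ) (D : W.FineSelmerDualData κ γ),
        Module.Finite ℤ_[p] (RestrictScalars ℤ_[p] (IwasawaAlgebra p) D.X) :=
    fun κ hκ ↦ (hLS W' W p hp hcong κ hκ).mp
      (WildFineSelmerOrdinaryAnchor.conjA_rat_of_finite_selmerInfty_pTorsion W' hfin' κ hκ)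
  -- Kato's A161″ conclusion at `W` (p420034 at the Conj-A binding) in Miller's currency
  have hL : W.entireLFunction 1 ≠ 0 := (W.analyticRank_eq_zero_iff_holds (hmod W)).mp hr
  obtain ⟨-, hfin⟩ := hGZK W (by rw [hr]; exact zero_le_one)
  obtain ⟨q₀, hq₀, hle⟩ := WildFineSelmerCongruence.x4UpperOfFineMuZero_conjA hKatoA W p hp hA.1 hA.2
    hj hirr (fun κ hκ ↦ hAW κ hκ) hL hfin
  have ht0 : padicValNat p W.torsionOrder = 0 := padicValNat_torsionOrder_eq_zero_of_irreducible W p hirr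
  obtain ⟨q, hq, hle'⟩ := exists_shaAn_le_add_torsion_of_katoCurrency hGZK hmod W p hr hfin hq₀
    (by rw [ht0, Nat.cast_zero, mul_zero, add_zero]; exact hle)
  refine ⟨q, hq, ?_⟩
  rw [ht0, Nat.cast_zero, add_zero] at hle'
  exact hle'

/-- **`TameFineSelmerCoatesSujatha` (item 19413) from per-row MIXED congruent certificates, under the
tree fact Lim–Sujatha.** If every row of the (t′) crux (rank `0`, `p ≠ 2`, `Addv`, `SubTprime`, `W[p]`
irreducible, `ρ̄` not onto mod `p^n` for some `n`, no CM) admits an elliptic `W′/ℚ` with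
`W′[p] ≃ W[p]` carrying EITHER (A) at `(W′,p)` OR finite `Sel_{p^∞}(W′/ℚ^cyc)[p]` for every cyclotomic
datum, then the BODY of the route decl holds verbatim (route-free; against the decl the term elaborates
by defeq unfolding). Conditional; the item is NOT closed. [cite: LimSujatha2018, §3 Prop. 3.2]
[cite: GreenbergVatsal2000, §2 Prop. (2.8)] -/
theorem tameFineSelmerCoatesSujatha_of_mixedCertificates
    (hLS : LimSujatha2018.prop32_fineSelmerDual_moduleFinite_iff_of_torsionIso)
    (hcert : ∀ (W : WeierstrassCurve ℚ) [W.IsElliptic] [W.IsGloballyMinimal] (p : ℕ) [Fact p.Prime],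
      W.analyticRank = 0 → p ≠ 2 → Addv W p → SubTprime W p → W.HasIrreducibleModPGaloisRep p →
      ¬ (∀ n : ℕ, W.HasSurjectiveModNGaloisRep (p ^ n : ℕ)) → ¬ W.HasCM →
      ∃ (W' : WeierstrassCurve ℚ) (_ : W'.IsElliptic), ModPCongruent W' W p ∧
        ((∀ (κ : ZpExtension ℚ p), κ.IsCyclotomic →
            ∃ (γ : Field.absoluteGaloisGroup ℚ) (D : W'.FineSelmerDualData κ γ),
              Module.Finite ℤ_[p] (RestrictScalars ℤ_[p] (IwasawaAlgebra p) D.X)) ∨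
          ∀ (κ : ZpExtension ℚ p), κ.IsCyclotomic → Set.Finite {s : W'.selmerInfty κ | p • s = 0})) :
    ∀ (W : WeierstrassCurve ℚ) [W.IsElliptic] [W.IsGloballyMinimal] (p : ℕ) [Fact p.Prime],
      W.analyticRank = 0 → p ≠ 2 → Addv W p → SubTprime W p → W.HasIrreducibleModPGaloisRep p →
      ¬ (∀ n : ℕ, W.HasSurjectiveModNGaloisRep (p ^ n : ℕ)) → ¬ W.HasCM →
      ∀ (κ : ZpExtension ℚ p), κ.IsCyclotomic →
        ∃ (γ : Field.absoluteGaloisGroup ℚ) (D : W.FineSelmerDualData κ γ),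
          Module.Finite ℤ_[p] (RestrictScalars ℤ_[p] (IwasawaAlgebra p) D.X) := by
  intro W _ _ p _ hr hp hA hT hirr hns hcm κ hκ
  obtain ⟨W', hW', hcong, hcertW⟩ := hcert W p hr hp hA hT hirr hns hcm
  haveI := hW'
  refine (hLS W' W p hp hcong κ hκ).mp ?_
  rcases hcertW with hA' | hfin'
  · exact hA' κ hκ
  · exact WildFineSelmerOrdinaryAnchor.conjA_rat_of_finite_selmerInfty_pTorsion W' hfin' κ hκ

end Summit.BirchSwinnertonDyer.BirchSwinnertonDyer.Theorems.TameFineSelmerOrdinaryAnchor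

end
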